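import Literature.Probability.LatticeModels.NoPlusPercolation
import Literature.Probability.LatticeModels.IsingAutomorphismCovariance
import Literature.Probability.LatticeModels.IsingGibbsFlip
import Literature.Probability.LatticeModels.GibbsStrongMarkov
import Literature.Probability.LatticeModels.IsingBoundaryMonotonicity
import Literature.Probability.LatticeModels.IsingConsistency
import HarnessLib

/-!
# Flip-reflection domination (Georgii–Higuchi 2000, Lemma 2.2)

Topic `Probability/LatticeModels`. Georgii–Higuchi, J. Math. Phys. 41 (2000), Lemma 2.2 (p. 5), a
variant of a result of Russo: "Let `μ ∈ 𝒢` and `R` any reflection, and suppose that for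
`μ`-almost all `ω` each finite `Δ ⊂ ℤ²` is surrounded by an `R`-invariant `∗`circuit `c` such that
`ω ≥ R ∘ T(ω)` on `c`. Then `μ ≽ μ ∘ R ∘ T`" (`T` the spin flip). We prove it for the zero-field
Ising model on any locally finite graph with an **involutive automorphism** `R`, with the
circuit hypothesis replaced by its consequence actually used in the printed proof — for every
finite `Δ`, with probability `→ 1` along a sequence of `R`-invariant volumes `Λₙ`, `Δ` lies in an
`R`-invariant random volume `Γ ⊆ Λₙ` determined from outside with `ω ≥ R∘T(ω)` on `∂Γ` — realised
here by the exploration volume (`ExplorationVolume`) of `Λₙ` whose passable ("bad") sites are those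
where the boundary inequality fails, `badSites R ω = {z | ω z = -1 ∧ ω (R z) = -1}`.

Printed proof (p. 5), followed here: for increasing `𝓕_Δ`-measurable `f`, the strong Markov
property gives `μ(f) = μ(μ^·_Γ(f))`; on `{Δ ⊆ Γ}`, "`ω ≥ R∘T(ω)` on `∂Γ(ω)`. By stochastic
monotonicity, `μ^ω_{Γ(ω)}(f) ≥ μ^{R∘T(ω)}_{Γ(ω)}(f) = μ^ω_{Γ(ω)}(f ∘ R ∘ T)`, where the identity
follows from the `R`-invariance of `Γ` and the `R∘T`-invariance of the interaction. Hence
`μ(f) ≥ μ(f ∘ R ∘ T 1_{Γ ≠ ∅}) ≥ μ(f ∘ R ∘ T) - ε‖f‖`."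

* `flipRelabel R` — the map `R ∘ T : ω ↦ -(ω ∘ R⁻¹)`; `badSites R ω`;
* `Exitable.map_iso`, `explVolume_map_iso` — equivariance of the exploration volume under
  automorphisms; hence `R`-invariance of `Γ` (`explVolume_badSites_map_eq`);
* `isingExpect_fixed_flipRelabel` — `μ^{R∘T(ω)}_Γ(f) = μ^ω_Γ(f ∘ R ∘ T)` for `R`-invariant `Γ` at
  `h = 0` (`IsingAutomorphismCovariance` + `IsingGibbsFlip`);
* **`integral_flipRelabel_le_of_enclosure`** — Lemma 2.2: `μ(f ∘ R ∘ T) ≤ μ(f)` for all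
  nondecreasing local bounded measurable `f`.

## References

* H.-O. Georgii, Y. Higuchi, J. Math. Phys. 41 (2000) 1153–1169, Lemma 2.2, p. 5
  [GeorgiiHiguchi2000].
* L. Russo, Comm. Math. Phys. 67 (1979) 251–266 (the original flip-reflection argument).
-/

noncomputable section

open MeasureTheory Filter Topology Finset

namespace Literature.Probability.LatticeModels

variable {V : Type*}

/-! ### The flip-reflection and the bad sites -/

/-- The **flip-reflection** `R ∘ T`: `(flipRelabel R ω) z = -ω (R⁻¹ z)` — reflect the configuration by
the site bijection `R` and flip all spins (Georgii–Higuchi 2000, §2 and Lemma 2.2: `R ∘ T`). [cite: GeorgiiHiguchi2000, Lemma 2.2 (p. 5)] -/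
def flipRelabel (R : V ≃ V) (ω : SpinConfig V) : SpinConfig V := -configRelabel R ω

/-- `(flipRelabel R ω) z = -ω (R⁻¹ z)`. [cite: GeorgiiHiguchi2000, Lemma 2.2 (p. 5)] -/
@[simp] theorem flipRelabel_apply (R : V ≃ V) (ω : SpinConfig V) (z : V) :
    flipRelabel R ω z = -ω (R.symm z) := rfl

/-- `flipRelabel R = Neg ∘ configRelabel R`. [cite: GeorgiiHiguchi2000, Lemma 2.2 (p. 5)] -/
theorem flipRelabel_eq_neg_comp (R : V ≃ V) :
    flipRelabel R = (fun σ : SpinConfig V => -σ) ∘ configRelabel R := rfl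

/-- `R ∘ T` is measurable. [cite: GeorgiiHiguchi2000, Lemma 2.2 (p. 5)] -/
theorem measurable_flipRelabel (R : V ≃ V) : Measurable (flipRelabel R) :=
  measurable_neg.comp (configRelabel R).measurable

/-- The **bad sites** of `ω` for the reflection `R`: those `z` with `ω z = ω (R z) = -1`, i.e.
(for an involution `R`) exactly the sites where the boundary inequality `ω ≥ R∘T(ω)` of
Georgii–Higuchi's Lemma 2.2 fails. [cite: GeorgiiHiguchi2000, Lemma 2.2 (p. 5)] -/
def badSites (R : V ≃ V) (ω : SpinConfig V) : Set V := {z | ω z = -1 ∧ ω (R z) = -1}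

/-- Membership in the bad sites. [cite: GeorgiiHiguchi2000, Lemma 2.2 (p. 5)] -/
@[simp] theorem mem_badSites {R : V ≃ V} {ω : SpinConfig V} {z : V} :
    z ∈ badSites R ω ↔ ω z = -1 ∧ ω (R z) = -1 := Iff.rfl

/-- Off the bad sites the boundary inequality holds: `ω z ≥ (R∘T ω) z` for an involution `R`. [cite: GeorgiiHiguchi2000, Lemma 2.2 (p. 5)] -/
theorem flipRelabel_apply_le {R : V ≃ V} (hR : ∀ z, R (R z) = z) {ω : SpinConfig V} {z : V}
    (hz : z ∉ badSites R ω) : flipRelabel R ω z ≤ ω z := by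
  have hsymm : R.symm z = R z := by
    rw [Equiv.symm_apply_eq]; exact (hR z).symm
  rw [flipRelabel_apply, hsymm]
  rcases Int.units_eq_one_or (ω z) with h1 | h1
  · rw [h1]; exact intUnits_le_one _
  · have h2 : ω (R z) ≠ -1 := fun h2 => hz ⟨h1, h2⟩
    rw [h1, eq_neg_one_of_ne_one (u := -ω (R z)) (by
      intro h; apply h2; rw [← neg_neg (ω (R z)), h])]

/-- The bad sites form an `R`-invariant set (for an involution `R`). [cite: GeorgiiHiguchi2000, Lemma 2.2 (p. 5)] -/
theorem image_badSites {R : V ≃ V} (hR : ∀ z, R (R z) = z) (ω : SpinConfig V) :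
    R '' badSites R ω = badSites R ω := by
  ext z
  simp only [Set.mem_image, mem_badSites]
  constructor
  · rintro ⟨y, ⟨hy1, hy2⟩, rfl⟩
    exact ⟨hy2, by rw [hR]; exact hy1⟩
  · rintro ⟨h1, h2⟩
    exact ⟨R z, ⟨h2, by rw [hR]; exact h1⟩, hR z⟩

/-! ### Equivariance of the exploration volume under automorphisms -/

section Equivariance

variable {G : SimpleGraph V}

/-- Exitability is equivariant under graph automorphisms. [cite: GeorgiiHiguchi2000, Lemma 2.2 (p. 5)] -/
theorem Exitable.map_iso (φ : G ≃g G) {Λ : Finset V} {T : Set V} {y : V}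
    (h : Exitable G Λ T y) : Exitable G (Λ.map φ.toEquiv.toEmbedding) (φ '' T) (φ y) := by
  induction h with
  | @base y z hy hz hadj =>
    refine .base (z := φ z) ?_ ?_ ((φ.map_adj_iff).2 hadj)
    · rw [mem_map_toEmbedding_iff]
      show φ.toEquiv.symm (φ.toEquiv y) ∈ Λ
      rwa [Equiv.symm_apply_apply]
    · rw [mem_map_toEmbedding_iff]
      show φ.toEquiv.symm (φ.toEquiv z) ∉ Λ
      rwa [Equiv.symm_apply_apply]
  | @step y t hy ht hadj _ ih =>
    refine .step (t := φ t) ?_ ⟨t, ht, rfl⟩ ((φ.map_adj_iff).2 hadj) ih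
    rw [mem_map_toEmbedding_iff]
    show φ.toEquiv.symm (φ.toEquiv y) ∈ Λ
    rwa [Equiv.symm_apply_apply]

/-- Exitability is invariant under graph automorphisms. [cite: GeorgiiHiguchi2000, Lemma 2.2 (p. 5)] -/
theorem exitable_map_iso_iff (φ : G ≃g G) {Λ : Finset V} {T : Set V} {y : V} :
    Exitable G (Λ.map φ.toEquiv.toEmbedding) (φ '' T) (φ y) ↔ Exitable G Λ T y := by
  refine ⟨fun h => ?_, Exitable.map_iso φ⟩
  have h' := h.map_iso φ.symm
  have hΛ : (Λ.map φ.toEquiv.toEmbedding).map φ.symm.toEquiv.toEmbedding = Λ := by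
    rw [Finset.map_map]
    have : φ.toEquiv.toEmbedding.trans φ.symm.toEquiv.toEmbedding = Function.Embedding.refl V := by
      ext x; exact φ.toEquiv.symm_apply_apply x
    rw [this, Finset.map_refl]
  have hT : φ.symm '' (φ '' T) = T := by
    rw [Set.image_image]
    have : (fun x => φ.symm (φ x)) = id := funext fun x => φ.symm_apply_apply x
    rw [this, Set.image_id]
  have hy : φ.symm (φ y) = y := φ.symm_apply_apply y
  rwa [hΛ, hT, hy] at h'

/-- **The exploration volume is equivariant under graph automorphisms**:
`explVolume (φ Λ) (φ T) = φ (explVolume Λ T)`. [cite: GeorgiiHiguchi2000, Lemma 2.2 (p. 5)] -/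
theorem explVolume_map_iso (φ : G ≃g G) (Λ : Finset V) (T : Set V) :
    explVolume G (Λ.map φ.toEquiv.toEmbedding) (φ '' T) =
      (explVolume G Λ T).map φ.toEquiv.toEmbedding := by
  ext z
  rw [mem_explVolume_iff, mem_map_toEmbedding_iff, mem_map_toEmbedding_iff, mem_explVolume_iff]
  have hz : z = φ (φ.toEquiv.symm z) := (φ.toEquiv.apply_symm_apply z).symm
  constructor
  · rintro ⟨hzΛ, hnot⟩
    exact ⟨hzΛ, fun hex => hnot (by rw [hz]; exact hex.map_iso φ)⟩
  · rintro ⟨hzΛ, hnot⟩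
    exact ⟨hzΛ, fun hex => hnot (by rw [hz, exitable_map_iso_iff] at hex; exact hex)⟩

/-- **The exploration volume of the bad sites is `R`-invariant** when the volume is (Georgii–Higuchi
2000, proof of Lemma 2.2: "an `R`-invariant `Γ(ω) ⊃ Δ`"). [cite: GeorgiiHiguchi2000, Lemma 2.2 (p. 5)] -/
theorem explVolume_badSites_map_eq (R : G ≃g G) (hR : ∀ z, R (R z) = z) {Λ : Finset V}
    (hΛ : Λ.map R.toEquiv.toEmbedding = Λ) (ω : SpinConfig V) :
    (explVolume G Λ (badSites R.toEquiv ω)).map R.toEquiv.toEmbedding =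
      explVolume G Λ (badSites R.toEquiv ω) := by
  rw [← explVolume_map_iso R Λ, hΛ]
  congr 1
  exact image_badSites (R := R.toEquiv) hR ω

end Equivariance

/-! ### Determination from outside, covariance and boundary monotonicity -/

section Ising

variable {G : SimpleGraph V} [DecidableEq V] [G.LocallyFinite]

omit [G.LocallyFinite] in
/-- **`{Γ = S} ∈ 𝓕_{Sᶜ}` for the exploration volume of the bad sites in an `R`-invariant volume**
(Georgii–Higuchi 2000, proof of Lemma 2.2: "the events `{Γ = G}` are measurable with respect to
`𝓕_{Λ∖G}`"): for `R`-invariant `S` the event is decided by the spins in `Λ \ S` (which is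
`R`-invariant, so it sees both `z` and `R z`); for other `S` it is empty, `Γ` being `R`-invariant. [cite: GeorgiiHiguchi2000, Lemma 2.2 (p. 5)] -/
theorem measurableSet_explVolume_badSites_eq (R : G ≃g G) (hR : ∀ z, R (R z) = z) {Λ : Finset V}
    (hΛ : Λ.map R.toEquiv.toEmbedding = Λ) (S : Finset V) :
    MeasurableSet[cylinderEvents (X := fun _ : V => ℤˣ) ((↑S : Set V)ᶜ)]
      {ω : SpinConfig V | explVolume G Λ (badSites R.toEquiv ω) = S} := by
  by_cases hS : S.map R.toEquiv.toEmbedding = S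
  · -- decided by the spins in the `R`-invariant set `Λ \ S`
    have hmemΛ : ∀ {z}, z ∈ Λ → R z ∈ Λ := fun {z} hz => by
      have := Finset.mem_map_of_mem R.toEquiv.toEmbedding hz
      rwa [hΛ] at this
    have hmemS : ∀ {z}, z ∉ S → R z ∉ S := fun {z} hz hRz => hz (by
      have := Finset.mem_map_of_mem R.toEquiv.toEmbedding hRz
      rw [hS] at this
      change R.toEquiv (R.toEquiv z) ∈ S at this
      rwa [show R.toEquiv (R.toEquiv z) = z from hR z] at this)
    have hK : MeasurableSet[cylinderEvents (X := fun _ : V => ℤˣ) (↑(Λ \ S) : Set V)]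
        {ω : SpinConfig V | explVolume G Λ (badSites R.toEquiv ω) = S} := by
      refine measurableSet_cylinderEvents_of_forall_eq fun ω ω' hωω' => ?_
      simp only [Set.mem_setOf_eq]
      rw [explVolume_eq_iff (T := badSites R.toEquiv ω), explVolume_eq_iff (T := badSites R.toEquiv ω')]
      have hT : badSites R.toEquiv ω ∩ (↑Λ \ ↑S) = badSites R.toEquiv ω' ∩ (↑Λ \ ↑S) := by
        ext z
        simp only [Set.mem_inter_iff, mem_badSites, Set.mem_sdiff, Finset.mem_coe]
        constructor
        · rintro ⟨⟨h1, h2⟩, hzΛ, hzS⟩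
          have e1 := hωω' z (Finset.mem_sdiff.2 ⟨hzΛ, hzS⟩)
          have e2 := hωω' (R z) (Finset.mem_sdiff.2 ⟨hmemΛ hzΛ, hmemS hzS⟩)
          exact ⟨⟨e1 ▸ h1, e2 ▸ h2⟩, hzΛ, hzS⟩
        · rintro ⟨⟨h1, h2⟩, hzΛ, hzS⟩
          have e1 := hωω' z (Finset.mem_sdiff.2 ⟨hzΛ, hzS⟩)
          have e2 := hωω' (R z) (Finset.mem_sdiff.2 ⟨hmemΛ hzΛ, hmemS hzS⟩)
          exact ⟨⟨e1.symm ▸ h1, e2.symm ▸ h2⟩, hzΛ, hzS⟩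
      rw [hT]
    refine cylinderEvents_mono (fun x hx => ?_) _ hK
    simp only [Finset.coe_sdiff, Set.mem_sdiff, Finset.mem_coe] at hx
    exact hx.2
  · -- `Γ` is `R`-invariant, so the event is empty
    have hempty : {ω : SpinConfig V | explVolume G Λ (badSites R.toEquiv ω) = S} = ∅ := by
      ext ω
      simp only [Set.mem_setOf_eq, Set.mem_empty_iff_false, iff_false]
      intro hΓ
      apply hS
      rw [← hΓ]
      exact explVolume_badSites_map_eq R hR hΛ ω
    rw [hempty]
    exact @MeasurableSet.empty _ (cylinderEvents (X := fun _ : V => ℤˣ) ((↑S : Set V)ᶜ))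

/-- **`μ^{R∘T(ω)}_Γ(f) = μ^ω_Γ(f ∘ R ∘ T)` for an `R`-invariant volume at zero field** (Georgii–Higuchi
2000, proof of Lemma 2.2: "the identity follows from the `R`-invariance of `Γ` and the
`R∘T`-invariance of the interaction"; here from the flip covariance `isingMeasure_fixed_map_neg`
and the automorphism covariance `isingExpect_fixed_relabel`). [cite: GeorgiiHiguchi2000, Lemma 2.2 (p. 5)] -/
theorem isingExpect_fixed_flipRelabel (R : G ≃g G) {Γ : Finset V}
    (hΓ : Γ.map R.toEquiv.toEmbedding = Γ) (β : ℝ) (ω : SpinConfig V)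
    {f : SpinConfig V → ℝ} (hf : Measurable f) :
    isingExpect G Γ β 0 (.fixed (flipRelabel R.toEquiv ω)) f =
      isingExpect G Γ β 0 (.fixed ω) (f ∘ flipRelabel R.toEquiv) := by
  have hfn : Measurable (f ∘ fun σ : SpinConfig V => -σ) := hf.comp measurable_neg
  -- the flip
  have h1 : isingExpect G Γ β 0 (.fixed (flipRelabel R.toEquiv ω)) f =
      isingExpect G Γ β 0 (.fixed (configRelabel R.toEquiv ω)) (f ∘ fun σ : SpinConfig V => -σ) := by
    rw [isingExpect, isingExpect, flipRelabel, ← isingMeasure_fixed_map_neg,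
      integral_map measurable_neg.aemeasurable hf.aestronglyMeasurable]
    rfl
  -- the reflection
  have h2 := isingExpect_fixed_relabel G R Γ β 0 ω hfn
  rw [hΓ] at h2
  rw [h1, h2]
  rfl

/-- **Monotonicity in the boundary condition, boundary form** (Friedli–Velenik 2017,
Exercise 3.13 with the locality of §3.6.3): if `η₁ ≤ η₂` on the outer boundary of `Γ`, then
`μ^{η₁}_Γ(f) ≤ μ^{η₂}_Γ(f)` for every nondecreasing measurable `f` depending only on the spins in
`Γ` (`β ≥ 0`). [cite: FriedliVelenik2017, Exercise 3.13] -/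
theorem isingExpect_fixed_le_of_le_on_outerBoundary {β : ℝ} (hβ : 0 ≤ β) (Γ : Finset V) (h : ℝ)
    {η₁ η₂ : SpinConfig V} (hle : ∀ z ∈ outerBoundary G Γ, η₁ z ≤ η₂ z)
    {f : SpinConfig V → ℝ} (hf : Monotone f) (hfm : Measurable f)
    (hfΓ : ∀ σ σ' : SpinConfig V, (∀ x ∈ Γ, σ x = σ' x) → f σ = f σ') :
    isingExpect G Γ β h (.fixed η₁) f ≤ isingExpect G Γ β h (.fixed η₂) f := by
  classical
  set η' : SpinConfig V := fun z => if z ∈ outerBoundary G Γ then η₁ z else η₂ z with hη'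
  have hcongr : isingExpect G Γ β h (.fixed η₁) f = isingExpect G Γ β h (.fixed η') f :=
    isingExpect_fixed_congr_outerBoundary G (fun y hy => by
      show η₁ y = if y ∈ outerBoundary G Γ then η₁ y else η₂ y
      rw [if_pos hy]) β h hfm hfΓ
  have hle' : η' ≤ η₂ := fun z => by
    show (if z ∈ outerBoundary G Γ then η₁ z else η₂ z) ≤ η₂ z
    by_cases hz : z ∈ outerBoundary G Γ
    · rw [if_pos hz]; exact hle z hz
    · rw [if_neg hz]
  rw [hcongr]
  exact isingExpect_fixed_mono G hβ Γ h hle' hf hfm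

/-! ### Lemma 2.2 -/

variable [Countable V]

/-- **Georgii–Higuchi 2000, Lemma 2.2 (Flip-reflection domination).** Zero-field Ising model on a
locally finite graph `G` with countable vertex set, `β ≥ 0`, an involutive automorphism `R`, and
`μ ∈ 𝒢(β, 0)`. Suppose that along a sequence of `R`-invariant finite volumes `Λₙ`, for every
finite `Δ`, the probability that `Δ` is *not* enclosed by the exploration volume of `Λₙ` with
respect to the bad sites `{ω = ω∘R = -1}` tends to `0` (this is how the printed hypothesis "each
finite `Δ` is surrounded by an `R`-invariant `∗`circuit on which `ω ≥ R∘T(ω)`" is used). Then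
`μ ≽ μ ∘ (R∘T)⁻¹`: `∫ f ∘ R ∘ T dμ ≤ ∫ f dμ` for every nondecreasing, local, bounded measurable
`f`. Proof as printed (p. 5), see the module docstring. [cite: GeorgiiHiguchi2000, Lemma 2.2 (p. 5)] -/
theorem integral_flipRelabel_le_of_enclosure {β : ℝ} (hβ : 0 ≤ β) (R : G ≃g G)
    (hR : ∀ z, R (R z) = z) {μ : Measure (SpinConfig V)}
    (hμ : IsGibbsMeasure (isingSpecification G β 0) μ)
    (Λ : ℕ → Finset V) (hΛ : ∀ n, (Λ n).map R.toEquiv.toEmbedding = Λ n)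
    (hencl : ∀ Δ : Finset V, Tendsto (fun n => μ {ω : SpinConfig V |
      Δ ⊆ explVolume G (Λ n) (badSites R.toEquiv ω)}ᶜ) atTop (𝓝 0))
    {f : SpinConfig V → ℝ} (hf : Monotone f) (hfm : Measurable f) {Δ : Finset V}
    (hfD : DependsOn f (↑Δ : Set V)) {C : ℝ} (hC : ∀ σ, |f σ| ≤ C) :
    ∫ σ, f (flipRelabel R.toEquiv σ) ∂μ ≤ ∫ σ, f σ ∂μ := by
  set γ := isingSpecification G β 0 with hγdef
  have hγ : IsSpecification γ := isSpecification_isingSpecification_holds G β 0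
  haveI := hμ.isProbabilityMeasure
  have hprob : ∀ (S : Finset V) (η : SpinConfig V), IsProbabilityMeasure (γ S η) :=
    fun S η => hγ.isProbability S η
  -- the flipped-reflected observable
  set g : SpinConfig V → ℝ := f ∘ flipRelabel R.toEquiv with hg
  have hgm : Measurable g := hfm.comp (measurable_flipRelabel R.toEquiv)
  have hgC : ∀ σ, |g σ| ≤ C := fun σ => hC _
  -- random volumes, events, conditional expectations
  let Γ : ℕ → SpinConfig V → Finset V := fun n ω => explVolume G (Λ n) (badSites R.toEquiv ω)
  let A : ℕ → Set (SpinConfig V) := fun n => {ω | Δ ⊆ Γ n ω}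
  let F : ℕ → SpinConfig V → ℝ := fun n ω => ∫ σ, f σ ∂(γ (Γ n ω) ω)
  let Gg : ℕ → SpinConfig V → ℝ := fun n ω => ∫ σ, g σ ∂(γ (Γ n ω) ω)
  have hΓ : ∀ n (S : Finset V), MeasurableSet[cylinderEvents (X := fun _ : V => ℤˣ) ((↑S : Set V)ᶜ)]
      {ω | Γ n ω = S} := fun n S => measurableSet_explVolume_badSites_eq R hR (hΛ n) S
  have hΓm : ∀ n (S : Finset V), MeasurableSet {ω | Γ n ω = S} := fun n S =>
    cylinderEvents_le_pi _ (hΓ n S)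
  have hA : ∀ n, MeasurableSet (A n) := by
    intro n
    have hU : A n = ⋃ S ∈ (Λ n).powerset.filter (fun S => Δ ⊆ S), {ω | Γ n ω = S} := by
      ext ω
      simp only [A, Set.mem_setOf_eq, Set.mem_iUnion, Finset.mem_filter, Finset.mem_powerset,
        exists_prop]
      constructor
      · intro hΔ
        exact ⟨_, ⟨explVolume_subset _ _, hΔ⟩, rfl⟩
      · rintro ⟨S, ⟨-, hΔS⟩, hS⟩
        change explVolume G (Λ n) (badSites R.toEquiv ω) = S at hS
        show Δ ⊆ explVolume G (Λ n) (badSites R.toEquiv ω)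
        rwa [hS]
    rw [hU]
    exact Finset.measurableSet_biUnion _ fun S _ => hΓm n S
  -- strong Markov for `f` and for `g`
  have hSMf : ∀ n, ∫ σ, f σ ∂μ = ∫ ω, F n ω ∂μ := fun n => hμ.integral_strongMarkov hγ (hΓ n) hfm hC
  have hSMg : ∀ n, ∫ σ, g σ ∂μ = ∫ ω, Gg n ω ∂μ := fun n => hμ.integral_strongMarkov hγ (hΓ n) hgm hgC
  -- bounds and integrability
  have hbnd : ∀ {u : SpinConfig V → ℝ}, (∀ σ, |u σ| ≤ C) → ∀ n ω,
      |∫ σ, u σ ∂(γ (Γ n ω) ω)| ≤ C := by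
    intro u hu n ω
    haveI := hprob (Γ n ω) ω
    have h1 : ‖∫ σ, u σ ∂(γ (Γ n ω) ω)‖ ≤ C * (γ (Γ n ω) ω).real Set.univ :=
      norm_integral_le_of_norm_le_const (ae_of_all _ fun σ => by
        rw [Real.norm_eq_abs]; exact hu σ)
    rwa [probReal_univ, mul_one, Real.norm_eq_abs] at h1
  have hmeas : ∀ {u : SpinConfig V → ℝ}, Measurable u → (∀ σ, |u σ| ≤ C) → ∀ n,
      Measurable fun ω => ∫ σ, u σ ∂(γ (Γ n ω) ω) := by
    intro u hum hu n
    have hG : Measurable fun ω => ∫⁻ σ, ENNReal.ofReal (u σ + C) ∂(γ (Γ n ω) ω) :=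
      hγ.measurable_lintegral_randomVolume (hΓm n) (hum.add_const C).ennreal_ofReal
    have hFeq : (fun ω => ∫ σ, u σ ∂(γ (Γ n ω) ω)) =
        fun ω => (∫⁻ σ, ENNReal.ofReal (u σ + C) ∂(γ (Γ n ω) ω)).toReal - C := by
      funext ω
      haveI := hprob (Γ n ω) ω
      have := integral_add_eq_toReal_lintegral (γ (Γ n ω) ω) hum hu
      linarith
    rw [hFeq]
    exact hG.ennreal_toReal.sub_const C
  have hFi : ∀ n, Integrable (F n) μ := fun n =>
    (integrable_const C).mono' (hmeas hfm hC n).aestronglyMeasurable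
      (ae_of_all _ fun ω => by rw [Real.norm_eq_abs]; exact hbnd hC n ω)
  have hGi : ∀ n, Integrable (Gg n) μ := fun n =>
    (integrable_const C).mono' (hmeas hgm hgC n).aestronglyMeasurable
      (ae_of_all _ fun ω => by rw [Real.norm_eq_abs]; exact hbnd hgC n ω)
  -- on `A n`: `G_n ≤ F_n` (covariance and boundary monotonicity)
  have hGF : ∀ n, ∀ ω ∈ A n, Gg n ω ≤ F n ω := by
    intro n ω hω
    have hΓR : (Γ n ω).map R.toEquiv.toEmbedding = Γ n ω := explVolume_badSites_map_eq R hR (hΛ n) ω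
    have hfΓ : ∀ σ σ' : SpinConfig V, (∀ x ∈ Γ n ω, σ x = σ' x) → f σ = f σ' :=
      fun σ σ' hσ => hfD fun x hx => hσ x (hω (Finset.mem_coe.1 hx))
    change isingExpect G (Γ n ω) β 0 (.fixed ω) g ≤ isingExpect G (Γ n ω) β 0 (.fixed ω) f
    rw [hg, ← isingExpect_fixed_flipRelabel R hΓR β ω hfm]
    refine isingExpect_fixed_le_of_le_on_outerBoundary hβ (Γ n ω) 0 (fun z hz => ?_) hf hfm hfΓ
    rw [mem_outerBoundary_iff] at hz
    obtain ⟨hzΓ, y, hy, hadj⟩ := hz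
    exact flipRelabel_apply_le hR (not_mem_of_adj_explVolume hy hzΓ hadj.symm).2
  -- the estimate `μ(g) ≤ μ(f) + 2C μ(A nᶜ)`
  have hest : ∀ n, ∫ σ, g σ ∂μ ≤ ∫ σ, f σ ∂μ + 2 * C * μ.real (A n)ᶜ := by
    intro n
    rw [hSMg n, hSMf n, ← integral_add_compl (hA n) (hGi n), ← integral_add_compl (hA n) (hFi n)]
    have h1 : ∫ ω in A n, Gg n ω ∂μ ≤ ∫ ω in A n, F n ω ∂μ :=
      setIntegral_mono_on (hGi n).integrableOn (hFi n).integrableOn (hA n) (hGF n)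
    have h2 : ∫ ω in (A n)ᶜ, Gg n ω ∂μ ≤ C * μ.real (A n)ᶜ := by
      calc ∫ ω in (A n)ᶜ, Gg n ω ∂μ ≤ ∫ _ in (A n)ᶜ, C ∂μ :=
            setIntegral_mono_on (hGi n).integrableOn integrableOn_const (hA n).compl
              fun ω _ => (le_abs_self _).trans (hbnd hgC n ω)
        _ = C * μ.real (A n)ᶜ := by rw [setIntegral_const, smul_eq_mul, mul_comm]
    have h3 : -(C * μ.real (A n)ᶜ) ≤ ∫ ω in (A n)ᶜ, F n ω ∂μ := by
      calc -(C * μ.real (A n)ᶜ) = ∫ _ in (A n)ᶜ, -C ∂μ := by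
            rw [setIntegral_const, smul_eq_mul, mul_neg, mul_comm]
        _ ≤ ∫ ω in (A n)ᶜ, F n ω ∂μ :=
            setIntegral_mono_on integrableOn_const (hFi n).integrableOn (hA n).compl
              fun ω _ => (neg_abs_le _).trans' (neg_le_neg (hbnd hC n ω))
    linarith
  -- let `n → ∞`
  have hcompl : Tendsto (fun n => μ.real (A n)ᶜ) atTop (𝓝 0) := by
    have h0 := (ENNReal.tendsto_toReal ENNReal.zero_ne_top).comp (hencl Δ)
    rw [ENNReal.toReal_zero] at h0
    exact h0
  have hlim : Tendsto (fun n => ∫ σ, f σ ∂μ + 2 * C * μ.real (A n)ᶜ) atTop (𝓝 (∫ σ, f σ ∂μ)) := by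
    simpa using (hcompl.const_mul (2 * C)).const_add (∫ σ, f σ ∂μ)
  exact ge_of_tendsto' hlim hest

end Ising

end Literature.Probability.LatticeModels
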